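/-
Copyright: audit package `pub-balaban` (b2b), unit `b2b-balaban-pv09-g11` (SURGE NODE PROVER #09, gen 11).
Released under the licence of the host repository.
-/
import Literature.MathematicalPhysics.QuantumFieldTheory.Balaban1983to89.Beta.AxialProjector
import Literature.MathematicalPhysics.QuantumFieldTheory.Balaban1983to89.B6Constraint2153QvOp

/-!
# Bałaban 1984 (Propagators I ∕ II), (1.10) ∕ (2.153): the constraint «B(Γ_{y,x}) = 0 for x ∈ B(y)» — the β cell's
# axial gauge `Beta.AveragingContours.AxialGauge` IS b06 ∕ pv09's tree-bond constraint (`treeBonds`, `IsTree`),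
# and (2.153) for the genuine Δ_k under BOTH β-cell constraints

T. Bałaban, *Propagators and renormalization transformations for lattice gauge theories. I*, Commun. Math. Phys.
**95** (1984) 17–40 (= [Balaban1984PropagatorsI]), p. 18 [PDF 2] formulas (1.6), (1.7) and p. 19 [PDF 3] formula
(1.10); T. Bałaban, *Propagators and renormalization transformations for lattice gauge theories. II*, Commun. Math.
Phys. **96** (1984) 223–250 (= [Balaban1984PropagatorsII]), p. 249 [PDF 27] formula (2.153).

## The audited sentences (verbatim, read from the page images this session)

[Balaban1984PropagatorsI] p. 18 [PDF 2] (render `…1984-cmp95-propagators-rt-I-p002-x2.png`): «B(y) = {x∈T₁ : y_μ ≦ x_μ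
< y_μ + L, μ = 1, …, d}, y∈T_L^{(1)}. (1.6) In each block B(y) we introduce a family of contours Γ_{y,x} connecting the
points y and x: Γ_{y,x} = [y,(y₁, …, y_{d−1}, x_d)] ∪ … ∪ [(y₁, …, y_μ, x_{μ+1}, …, x_d), (y₁, …, x_μ, x_{μ+1}, …, x_d)]
∪ … ∪ [(y₁, x₂, …, x_d), x], (1.7) where [x₁, x₂] is a line segment connecting points x₁, x₂. We consider Γ_{y,x},
and all other contours appearing in the paper, as oriented contours, with initial point y and final point x.»

[Balaban1984PropagatorsI] p. 19 [PDF 3] (render `…-p003-x2.png`): «where A(Γ) = Σ_{b⊂Γ} A_b for arbitrary contour Γ»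
and «we remove it by introducing Axial (Ax) gauge fixing conditions A(Γ_{y,x}) = 0, x∈B(y), x ≠ y, y∈T_L^{(1)}. If we
denote δ_{Ax}(A) = Π_{y∈T_L^{(1)}} Π_{x∈B(y), x≠y} δ(A(Γ_{y,x})), (1.10)».

[Balaban1984PropagatorsII] p. 249 [PDF 27] (render `…1984-cmp96-propagators-rt-II-p027-x2.png`): «⟨B, Δ_kB⟩ ≧
(γ₀/12d²)L^{−d−1}‖B‖², or Δ_k ≧ (γ₀/12d²)L^{−d−1} (2.153) on the subspace of B satisfying: QB = 0, B(Γ_{y,x}) = 0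
for x ∈ B(y).» and, same page: «We remove the variables B_b for b⊂Γ_{y,x} using the δ-functions δ_{Ax}(B).»

## What this module certifies — ONE JUNCTION (every d, every L; torus part: every L ≥ 1, every coarse torus)

The package types the axial gauge (1.10) ∕ the second constraint of (2.153) TWICE, in two lineages that never met:
* β (an1 node 5, `Beta.AveragingContours`, v1.1 p186999): the contour Γ_{Y,x} of (1.7) as a LETTER LIST
  `axial A Y x` of a one-form `A : Form1 d R = Fin d → (Fin d → ℤ) → R` («first the segment moving x_d, last the one
  moving x₁», intermediate corners `corner Y x m`, unit vector `unitVec κ = Pi.single κ 1`), and (1.10) as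
  `AxialGauge A L := ∀ y b, b ∈ box d L → (axial A (L•y) (L•y + b)).sum = 0`; downstream `Beta.AxialProjector.axProj`
  («A is axial iff Π A = A», `axialGauge_iff_axProj_eq`).
* b06 ∕ pv09 (the (2.128)→(2.153)→(2.157) line, `B6BondElimination`): the same contour as a FINSET OF BONDS
  `contour L Y x ⊂ (Fin d → ℤ) × Fin d` (bond (w, μ) = ⟨w, w + e_μ⟩, `unitVec μ = fun i => if i = μ then 1 else 0`),
  the tree Γ_Y = ⋃_x Γ_{Y,x} as `treeBonds L Y`, the equivalence `axial_iff` («A(Γ_{Y,x}) = 0 ∀ x ∈ B(Y), x ≠ Y ⟺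
  A_b = 0 ∀ b ∈ Γ_Y»), its torus transport `B6Lemma24Torus.treeGauge_all` ∕ `IsTree L (coarseSites L M)`, and the
  hypothesis `hT : ∀ p, IsTree L (coarseSites L M) p → F (idxEquiv M p) = 0` of (2.153) for the genuine Δ_k
  (`B6Constraint2153QvOp.lower2153_DelK_of_QvOp`, whose HONEST SCOPE (iii) records: «identification with the β cell's
  axial-gauge objects (`Beta.AxialProjector`, …) is NOT asserted»).

PROVED HERE (zero `sorry`; finite bookkeeping — [folklore] junctions; NO printed statement enters as a hypothesis,
ABSOLUTE RULE):
* §1 **THE CONTOUR DICTIONARY** `axial_sum_eq_contour_sum`: for every one-form A (any additive group), every y and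
  every offset b ∈ {0,…,L−1}^d, `(axial A (L•y) (L•y + b)).sum = Σ_{p ∈ contour L (L•y) (L•y + b)} A p.2 p.1` — β's
  A(Γ_{Y,x}) IS b06's A(Γ_{Y,x}) (the bijection letter (μ, s) ↦ bond (corner_{μ+1} + s e_μ, μ); `unitVec_eq`: the two
  e_μ coincide; `axialAux_sum_eq`: the partial contour over the directions < m).
* §2 **THE AXIAL-GAUGE DICTIONARY on Z^d** (ℝ-valued forms): `axialGauge_iff_treeBonds : AxialGauge A L ↔ ∀ y, ∀ p ∈
  treeBonds L (L•y), A p.2 p.1 = 0` and `axialGauge_iff_treeBonds_dvd` (blocks indexed by Y ∈ LZ^d); `mem_block_smul_iff`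
  (B(L•y) = L•y + {0,…,L−1}^d, (1.6)).
* §3 **on the torus** (L ∣ M_i): for a real field F on `Tor M × Fin d` and its periodic one-form `liftForm M F μ x :=
  F (x mod M, μ)` (= pv09's `lift`): `axialGauge_liftForm_iff : AxialGauge (liftForm M F) L ↔ ∀ y ∈ coarseSites L M,
  ∀ b ∈ treeBonds L y, lift M F b = 0`, `axialGauge_liftForm_iff_isTree : … ↔ ∀ p, IsTree L (coarseSites L M) p →
  F (idxEquiv M p) = 0`, and with β's projector `isTree_iff_axProj_eq : (∀ p, IsTree … → F (idxEquiv M p) = 0) ↔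
  axProj L (liftForm M F) = liftForm M F`.
* §4 **(2.153) for the genuine (1.65) operator under BOTH β-cell constraints**, `lower2153_DelK_axialGauge` (d ≥ 2,
  n ≥ 1, fine torus `Tor (L·M′)`): `QvOp L M′ *ᵥ F̃ = 0` (B5 (1.18), `B6Constraint2153QvOp`) and `AxialGauge (liftForm
  (L·M′) F) L` (B5 (1.10), β node 5) give `(1/12d²)L^{−d−1}·Σ_s F(s)² ≤ Re(F̃ᴴ·Δ_k·F̃)`, Δ_k =
  `Beta.BlockEffectiveAction.DelK n hn (L·M′) a ha` itself (← `lower2153_DelK_of_QvOp` + §3).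

HONEST SCOPE.  (i) §§1–2 are statements on Z^d for every d and L (L = 0 included, both sides degenerate); §§3–4 are
the torus model of both lineages (fine bonds `Tor M × Fin d`, L ∣ M_i, L ≥ 1).  (ii) (1.10) prints the conditions for
x ≠ y; β's `AxialGauge` includes x = y, where Γ_{y,y} is empty (`axial_self`, `contour_self`) — the dictionary shows the
two typings agree, it does not adjudicate the print beyond that.  (iii) «B(Γ_{y,x}) = 0» on p. 249 is for the field B
on T^{(k)} with the blocks of the (k+1)-st step; both lineages read Γ_{y,x} as the (1.7) contour of [I] — the only
reading typed in the package; no other is asserted or excluded.  (iv) NOT claimed: anything about δ_{Ax} as a measure ∕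
the Gaussian integrals (1.12), (2.154), the covariance C^{(k)}_Λ beyond `B6Cov2156TorusDelK`, Proposition 1.2, the
continuum limit.  Value = a junction certificate closing BY NAME non-assertion (iii) of `B6Constraint2153QvOp` (and the
informal «(2.121) = (1.10)» glosses of `B6BondElimination.axial_iff` ∕ `B6Lemma24Torus.treeGauge_all`) for the typed
objects, so that (2.153) for the genuine Δ_k is available under the β cell's own gauge predicate and projector; NOT
summit progress; NOT the continuum limit; NOT Clay.

Imported BY NAME, none edited: `…Beta.AxialProjector` (an2; hence `Beta.AveragingContours`, `Beta.AffineAveraging`),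
`…B6Constraint2153QvOp` (pv09-g11, p191334; hence `B6Cov2156TorusDelK`, `B6Cov2156Torus`, `B6LowerBound2153Torus`,
`B6Lemma24Torus`, `B6BondElimination`, `B6Elimination`, `B5Block118`, `B5Prop11Plancherel`, `B5Bounds167Lattice`,
`Beta.BlockEffectiveAction`).  Name clashes handled by qualification: `Balaban1983to89.Site` (Setup) vs
`Beta.AffineAveraging.Site` (written `Fin d → ℤ`), `Beta.AffineAveraging.box` ∕ `unitVec` ∕ `AxialGauge` and
`Beta.AveragingContours.corner` written in full.
Unit `b2b-balaban-pv09-g11` (SURGE NODE PROVER #09, gen 11), node G-B6-2153-AX-DICT (GAPS C-pv09g11-4); staged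
byte-identically under `HOME/lean/BalabanYm4/`.
-/

noncomputable section

open scoped BigOperators Matrix
open Finset Matrix

namespace Literature.MathematicalPhysics.QuantumFieldTheory.Balaban1983to89.B6AxialGaugeDictionary

open Beta.AffineAveraging (Form1 toSite)
open Beta.AveragingContours (segUp seg axialAux axial segUp_succ)
open Beta.AxialProjector (axProj axialGauge_iff_axProj_eq)
open B6Elimination (mem_block)
open B6BondElimination (IsTree contour mem_contour treeBonds mem_treeBonds axial_iff contour_self isTree_iff)
open B6Lemma24Torus (pbox mem_pbox coarseSites mem_coarseSites coarseSites_dvd block_subset_pbox treeGauge_all)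
open B6LowerBound2153Torus (toT lift lift_apply isPeriodic_lift)
open B6Cov2156TorusDelK (idxEquiv gamma2153one)
open B6Constraint2153QvOp (dvd_fine lower2153_DelK_of_QvOp)
open B5Prop11Plancherel (Tor fine)
open B5Block118 (QvOp)
open B5Bounds167Lattice (ofRealCfg)
open Beta.BlockEffectiveAction (DelK)

/-! ## §1 The contour dictionary: β's letter list of Γ_{Y,x} sums to b06's bond sum -/

section Contour

variable {d : ℕ} {R : Type*} [AddCommGroup R]

/-- β's `e_κ = Pi.single κ 1` IS b06's `e_κ = (i ↦ if i = κ then 1 else 0)`. [folklore] -/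
theorem unitVec_eq (κ : Fin d) : Beta.AffineAveraging.unitVec κ = B6BondElimination.unitVec κ := by
  funext i; rw [Beta.AffineAveraging.unitVec_apply, B6BondElimination.unitVec_apply]

omit [AddCommGroup R] in
/-- Membership in β's offset box {0,…,L−1}^d. [folklore] -/
theorem mem_box {L : ℕ} {b : Fin d → ℕ} : b ∈ Beta.AffineAveraging.box d L ↔ ∀ i, b i < L := by
  simp only [Beta.AffineAveraging.box, Fintype.mem_piFinset, Finset.mem_range]

/-- β's `segUp_sum` over any additive group (β states it in a `CommRing` section): the letters of a straight segment
of n bonds sum to Σ_{s<n} A_κ(z + s e_κ). [folklore] -/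
theorem segUp_sum' (A : Form1 d R) (z : Fin d → ℤ) (κ : Fin d) (n : ℕ) :
    (segUp A z κ n).sum = ∑ s ∈ Finset.range n, A κ (z + (s : ℤ) • Beta.AffineAveraging.unitVec κ) := by
  induction n with
  | zero => simp [segUp]
  | succ n ih => rw [segUp_succ, List.sum_append, ih, Finset.sum_range_succ, List.sum_singleton]

omit [AddCommGroup R] in
/-- Coordinates of the point L•y + b of the block B(L•y). [folklore] -/
theorem base_add_toSite_apply (L : ℕ) (y : (Fin d → ℤ)) (b : Fin d → ℕ) (i : Fin d) :
    ((L : ℤ) • y + toSite b) i = (L : ℤ) * y i + b i := by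
  simp [toSite, Pi.add_apply]

/-- The letters of the part of Γ_{Y,x} moving the coordinates of index < m (β's `axialAux A Y x m`) sum to
Σ_{μ<m} Σ_{s<b_μ} A_μ(corner_{μ+1} + s e_μ), for x = Y + b in the block of Y = L•y: the μ-th segment of (1.7) runs from
(Y₁,…,Y_μ, x_{μ+1},…,x_d) = `corner Y x (μ+1)` through b_μ bonds in direction +μ. [cite: Balaban1984PropagatorsI, (1.7) p.18] -/
theorem axialAux_sum_eq (A : Form1 d R) (L : ℕ) (y : (Fin d → ℤ)) (b : Fin d → ℕ) :
    ∀ m, m ≤ d → (axialAux A ((L : ℤ) • y) ((L : ℤ) • y + toSite b) m).sum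
      = ∑ μ ∈ (univ : Finset (Fin d)).filter (fun μ : Fin d => (μ : ℕ) < m),
          ∑ s ∈ range (b μ), A μ (Beta.AveragingContours.corner ((L : ℤ) • y) ((L : ℤ) • y + toSite b) (μ + 1)
            + (s : ℤ) • Beta.AffineAveraging.unitVec μ)
  | 0, _ => by simp [axialAux]
  | m + 1, hm => by
    have h : m < d := by omega
    rw [axialAux]
    simp only [h, dif_pos, List.sum_append]
    rw [axialAux_sum_eq A L y b m (by omega)]
    have hn : ((L : ℤ) • y + toSite b) ⟨m, h⟩ - ((L : ℤ) • y) ⟨m, h⟩ = (b ⟨m, h⟩ : ℤ) := by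
      rw [base_add_toSite_apply]; simp [Pi.smul_apply]
    rw [hn, seg, if_pos (Int.natCast_nonneg _), Int.toNat_natCast, segUp_sum']
    have hsplit : (univ : Finset (Fin d)).filter (fun μ : Fin d => (μ : ℕ) < m + 1)
        = insert ⟨m, h⟩ ((univ : Finset (Fin d)).filter (fun μ : Fin d => (μ : ℕ) < m)) := by
      ext μ
      simp only [mem_filter, mem_univ, true_and, mem_insert, Fin.ext_iff]
      omega
    rw [hsplit, sum_insert (by simp)]

/-- **THE CONTOUR DICTIONARY**: β's letter list of Γ_{Y,x} (an1 node 5 `axial`, «A(Γ) = Σ_{b⊂Γ} A_b») sums to b06's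
bond sum over `B6BondElimination.contour L Y x` (the bonds ⟨w, w + e_μ⟩ of Γ_{Y,x}: w_i = Y_i for i < μ, w_i = x_i for
i > μ, Y_μ ≤ w_μ < x_μ), for every x = Y + b of the block B(Y), Y = L•y — via the bijection (μ, s) ↦ (corner_{μ+1} +
s e_μ, μ), s < b_μ. [cite: Balaban1984PropagatorsI, (1.7) p.18] -/
theorem axial_sum_eq_contour_sum (A : Form1 d R) {L : ℕ} (y : (Fin d → ℤ)) {b : Fin d → ℕ} (hb : b ∈ Beta.AffineAveraging.box d L) :
    (axial A ((L : ℤ) • y) ((L : ℤ) • y + toSite b)).sum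
      = ∑ p ∈ contour L ((L : ℤ) • y) ((L : ℤ) • y + toSite b), A p.2 p.1 := by
  set Y : (Fin d → ℤ) := (L : ℤ) • y with hY
  set x : (Fin d → ℤ) := Y + toSite b with hx
  have hbL : ∀ i, b i < L := mem_box.1 hb
  have hxi : ∀ i, x i = Y i + b i := fun i => by simp [hx, toSite]
  rw [axial, axialAux_sum_eq A L y b d le_rfl]
  have hfilt : (univ : Finset (Fin d)).filter (fun μ : Fin d => (μ : ℕ) < d) = univ := by
    ext μ; simp
  rw [hfilt, Finset.sum_sigma']
  -- bijection (μ, s) ↦ (corner (μ+1) + s e_μ, μ)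
  refine Finset.sum_nbij' (fun q => (Beta.AveragingContours.corner Y x (q.1 + 1) + (q.2 : ℤ) • Beta.AffineAveraging.unitVec q.1, q.1))
    (fun p => ⟨p.2, (p.1 p.2 - Y p.2).toNat⟩) ?_ ?_ ?_ ?_ ?_
  · rintro ⟨μ, s⟩ hq
    rw [Finset.mem_sigma] at hq
    have hs : s < b μ := mem_range.1 hq.2
    rw [mem_contour]
    dsimp only
    have hw : ∀ i, (Beta.AveragingContours.corner Y x (μ + 1) + (s : ℤ) • Beta.AffineAveraging.unitVec μ) i
        = if (i : ℕ) < μ then Y i else if i = μ then Y i + s else x i := by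
      intro i
      simp only [Beta.AveragingContours.corner, Pi.add_apply, Pi.smul_apply, smul_eq_mul,
        Beta.AffineAveraging.unitVec_apply]
      by_cases h1 : (i : ℕ) < μ
      · have : ¬ (μ : ℕ) + 1 ≤ i := by omega
        have hne : i ≠ μ := fun e => by subst e; omega
        simp [h1, this, hne]
      · by_cases h2 : i = μ
        · subst h2; simp
        · have : (μ : ℕ) + 1 ≤ i := by
            have : (μ : ℕ) ≠ i := fun e => h2 (Fin.ext e.symm)
            omega
          simp [h1, h2, this]
    refine ⟨?_, ?_, ?_, ?_⟩
    · rw [mem_block]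
      intro i
      rw [hw i]
      have hbi := hbL i
      have hb0 : (0 : ℤ) ≤ (b i : ℤ) := Int.natCast_nonneg _
      split_ifs with h1 h2
      · constructor <;> omega
      · subst h2; constructor <;> omega
      · rw [hxi]; constructor <;> omega
    · intro i hi
      rw [hw i, if_pos (Fin.lt_def.1 hi)]
    · intro i hi
      have h1 : ¬ (i : ℕ) < μ := by have := Fin.lt_def.1 hi; omega
      have h2 : i ≠ μ := fun e => by subst e; exact lt_irrefl _ hi
      rw [hw i, if_neg h1, if_neg h2]
    · rw [hw μ, if_neg (lt_irrefl _), if_pos rfl, hxi]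
      have : (s : ℤ) < (b μ : ℤ) := by exact_mod_cast hs
      omega
  · rintro ⟨w, ν⟩ hp
    rw [mem_contour] at hp
    dsimp only at hp
    obtain ⟨hwb, h1, h2, h3⟩ := hp
    rw [Finset.mem_sigma]
    dsimp only
    refine ⟨mem_univ _, mem_range.2 ?_⟩
    have h4 := (mem_block.1 hwb ν).1
    have h5 : w ν < Y ν + b ν := by rw [← hxi]; exact h3
    have : ((w ν - Y ν).toNat : ℤ) = w ν - Y ν := Int.toNat_of_nonneg (by omega)
    omega
  · rintro ⟨μ, s⟩ hq
    dsimp only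
    simp [Pi.add_apply, Beta.AffineAveraging.unitVec_apply, Beta.AveragingContours.corner]
  · rintro ⟨w, ν⟩ hp
    rw [mem_contour] at hp
    dsimp only at hp ⊢
    obtain ⟨hwb, h1, h2, h3⟩ := hp
    have h4 := (mem_block.1 hwb ν).1
    have ht : ((w ν - Y ν).toNat : ℤ) = w ν - Y ν := Int.toNat_of_nonneg (by omega)
    refine Prod.ext ?_ rfl
    funext i
    simp only [Pi.add_apply, Pi.smul_apply, smul_eq_mul, Beta.AffineAveraging.unitVec_apply,
      Beta.AveragingContours.corner]
    by_cases hi : i = ν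
    · subst hi; simp [ht]
    · simp only [hi, if_false, mul_zero, add_zero]
      rcases lt_or_gt_of_ne (fun e => hi (Fin.ext e)) with hlt | hgt
      · rw [if_neg (by omega), h1 i (Fin.lt_def.2 hlt)]
      · rw [if_pos (by omega), h2 i (Fin.lt_def.2 hgt)]
  · rintro ⟨μ, s⟩ _
    rfl

end Contour

/-! ## §2 The axial-gauge dictionary on Z^d -/

section Gauge

variable {d : ℕ}

/-- (1.6): x ∈ B(L•y) iff x = L•y + b with b ∈ {0,…,L−1}^d (b06's `block` ↔ β's `box`).
[cite: Balaban1984PropagatorsI, (1.6) p.18] -/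
theorem mem_block_smul_iff {L : ℕ} (y x : Fin d → ℤ) :
    x ∈ B6Elimination.block L ((L : ℤ) • y) ↔ ∃ b ∈ Beta.AffineAveraging.box d L, x = (L : ℤ) • y + toSite b := by
  constructor
  · intro hx
    have h := mem_block.1 hx
    refine ⟨fun i => (x i - ((L : ℤ) • y) i).toNat, mem_box.2 fun i => ?_, ?_⟩
    · have := h i; omega
    · funext i
      have := h i
      simp only [Pi.add_apply, toSite]
      rw [Int.toNat_of_nonneg (by omega)]; ring
  · rintro ⟨b, hb, rfl⟩
    have hbL := mem_box.1 hb
    refine mem_block.2 fun i => ?_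
    have := hbL i
    simp only [Pi.add_apply, toSite]
    constructor <;> omega

/-- **THE AXIAL-GAUGE DICTIONARY on Z^d**: β's (1.10) predicate `AxialGauge A L` («A(Γ_{y,x}) = 0, x ∈ B(y)», every
block B(L•y) of Z^d) ⟺ b06's reading «A_b = 0 for every bond b of the tree Γ_{L•y} = ⋃_x Γ_{L•y,x}» (`treeBonds`, via
`B6BondElimination.axial_iff` and §1; the printed «x ≠ y» is immaterial: Γ_{y,y} = ∅).
[cite: Balaban1984PropagatorsI, (1.10) p.19] -/
theorem axialGauge_iff_treeBonds (A : Form1 d ℝ) (L : ℕ) :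
    Beta.AveragingContours.AxialGauge A L ↔ ∀ y : Fin d → ℤ, ∀ p ∈ treeBonds L ((L : ℤ) • y), A p.2 p.1 = 0 := by
  refine forall_congr' fun y => ?_
  rw [← axial_iff ((L : ℤ) • y) (fun p => A p.2 p.1)]
  constructor
  · intro h x hx _
    obtain ⟨b, hb, rfl⟩ := (mem_block_smul_iff y x).1 hx
    rw [← axial_sum_eq_contour_sum A y hb]
    exact h b hb
  · intro h b hb
    rw [axial_sum_eq_contour_sum A y hb]
    by_cases hx : (L : ℤ) • y + toSite b = (L : ℤ) • y
    · rw [hx, contour_self, Finset.sum_empty]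
    · exact h _ ((mem_block_smul_iff y _).2 ⟨b, hb, rfl⟩) hx

/-- The same with the blocks indexed by their base points «y ∈ T_L^{(1)} = T₁ ∩ LZ^d» (T₁ read as Z^d).
[cite: Balaban1984PropagatorsI, (1.10) p.19] -/
theorem axialGauge_iff_treeBonds_dvd (A : Form1 d ℝ) (L : ℕ) :
    Beta.AveragingContours.AxialGauge A L ↔ ∀ y : Fin d → ℤ, (∀ i, (L : ℤ) ∣ y i) → ∀ p ∈ treeBonds L y, A p.2 p.1 = 0 := by
  rw [axialGauge_iff_treeBonds]
  constructor
  · intro h y hy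
    have : y = (L : ℤ) • fun i => y i / L := funext fun i => by
      simp only [Pi.smul_apply, smul_eq_mul]; exact (Int.mul_ediv_cancel' (hy i)).symm
    rw [this]
    exact h _
  · intro h y
    exact h _ fun i => ⟨y i, by simp [Pi.smul_apply]⟩

end Gauge

/-! ## §3 The axial-gauge dictionary on the torus -/

section Torus

variable {d : ℕ}

variable (L : ℕ) [NeZero L] (M : Fin d → ℕ) [∀ μ, NeZero (M μ)]

/-- The β one-form of a real field F on the bonds of the torus `Tor M`: A_μ(x) := F(x mod M, μ) — pv09's Z^d-periodic
`B6LowerBound2153Torus.lift` in β's `Form1` shape. [folklore] -/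
def liftForm (F : Tor M × Fin d → ℝ) : Form1 d ℝ := fun μ x => F (toT M x, μ)

omit [NeZero L] [∀ μ, NeZero (M μ)] in
/-- Evaluation: `liftForm M F μ x = lift M F (x, μ)`. [folklore] -/
theorem liftForm_apply (F : Tor M × Fin d → ℝ) (μ : Fin d) (x : Fin d → ℤ) :
    liftForm M F μ x = lift M F (x, μ) := rfl

omit [NeZero L] in
/-- **THE AXIAL-GAUGE DICTIONARY on the torus, tree-bond form** (L ∣ M_i): β's `AxialGauge` of the periodic one-form
⟺ pv09's constraint «the lift vanishes on the tree bonds of every block B(y), y ∈ T′ = coarseSites» (periodicity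
transports it to every block of LZ^d: `B6Lemma24Torus.treeGauge_all`). [cite: Balaban1984PropagatorsII, (2.153) p.249] -/
theorem axialGauge_liftForm_iff (hLM : ∀ i, L ∣ M i) (F : Tor M × Fin d → ℝ) :
    Beta.AveragingContours.AxialGauge (liftForm M F) L ↔ ∀ y ∈ coarseSites L M, ∀ b ∈ treeBonds L y, lift M F b = 0 := by
  rw [axialGauge_iff_treeBonds_dvd]
  constructor
  · intro h y hy b hb
    exact h y (coarseSites_dvd y hy) b hb
  · intro h y hy b hb
    exact treeGauge_all (fun i => Nat.pos_of_ne_zero (NeZero.ne (M i))) hLM (isPeriodic_lift M F) h hy b hb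

/-- **THE AXIAL-GAUGE DICTIONARY on the torus, box form**: ⟺ the `IsTree` constraint on the variables of the box
(each torus bond once, transported by `idxEquiv`) — verbatim the hypothesis `hT` of the (2.153)→(2.157) torus line
(`B6Cov2156TorusDelK`, `B6Constraint2153QvOp.lower2153_DelK_of_QvOp`). [cite: Balaban1984PropagatorsII, (2.153) p.249] -/
theorem axialGauge_liftForm_iff_isTree (hLM : ∀ i, L ∣ M i) (F : Tor M × Fin d → ℝ) :
    Beta.AveragingContours.AxialGauge (liftForm M F) L
      ↔ ∀ p : B4.Idx (pbox M) d, IsTree L (coarseSites L M) p → F (idxEquiv M p) = 0 := by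
  have hL : 0 < L := Nat.pos_of_ne_zero (NeZero.ne L)
  rw [axialGauge_liftForm_iff L M hLM F]
  constructor
  · intro h p hp
    obtain ⟨y, hy, hb⟩ := (isTree_iff hL coarseSites_dvd p).1 hp
    exact h y hy _ hb
  · intro h y hy b hb
    have hx : b.1 ∈ pbox M := block_subset_pbox hLM hy (mem_treeBonds.1 hb).1
    exact h (⟨b.1, hx⟩, b.2) ((isTree_iff hL coarseSites_dvd _).2 ⟨y, hy, hb⟩)

/-- **… and with β's axial projector** (`Beta.AxialProjector`, «A is axial iff Π A = A»): the `IsTree` constraint of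
the torus line ⟺ the periodic one-form is fixed by `axProj L`. [cite: Balaban1984PropagatorsI, (1.10) p.19] -/
theorem isTree_iff_axProj_eq (hLM : ∀ i, L ∣ M i) (F : Tor M × Fin d → ℝ) :
    (∀ p : B4.Idx (pbox M) d, IsTree L (coarseSites L M) p → F (idxEquiv M p) = 0)
      ↔ axProj L (liftForm M F) = liftForm M F :=
  (axialGauge_liftForm_iff_isTree L M hLM F).symm.trans
    (axialGauge_iff_axProj_eq (Nat.one_le_iff_ne_zero.2 (NeZero.ne L)) _)

end Torus

/-! ## §4 (2.153) for the genuine Δ_k under BOTH β-cell constraints -/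

section DelK

variable {d : ℕ}

variable (L : ℕ) [NeZero L] (M' : Fin d → ℕ) [∀ μ, NeZero (M' μ)]

/-- **(2.153) for the genuine (1.65) operator Δ_k on the fine torus `Tor (L·M′)`, BOTH constraints in β-cell
vocabulary**: «QB = 0» as `QvOp L M′ *ᵥ F̃ = 0` (B5 (1.18), `B5Block118.QvOp`; junction `B6Constraint2153QvOp`) and
«B(Γ_{y,x}) = 0 for x ∈ B(y)» as `AxialGauge (liftForm (L·M′) F) L` (B5 (1.10), β node 5; junction §3) give
(1/12d²)L^{−d−1}·Σ_s F(s)² ≤ Re(F̃ᴴ·Δ_k·F̃), Δ_k = `Beta.BlockEffectiveAction.DelK n hn (L·M′) a ha`, F̃ = F read in ℂ.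
[cite: Balaban1984PropagatorsII, (2.153) p.249] -/
theorem lower2153_DelK_axialGauge (hd : 2 ≤ d) (n : ℕ) [NeZero n] (hn : 1 ≤ n) (a : ℝ) (ha : 0 < a)
    (F : Tor (fine L M') × Fin d → ℝ)
    (hQ : QvOp L M' *ᵥ ofRealCfg (fine L M') F = 0)
    (hAx : Beta.AveragingContours.AxialGauge (liftForm (fine L M') F) L) :
    gamma2153one d L * ∑ s, F s ^ 2
      ≤ (star (ofRealCfg (fine L M') F) ⬝ᵥ (DelK n hn (fine L M') a ha *ᵥ ofRealCfg (fine L M') F)).re :=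
  lower2153_DelK_of_QvOp L M' hd n hn a ha F hQ
    ((axialGauge_liftForm_iff_isTree L (fine L M') (dvd_fine L M') F).1 hAx)

end DelK

end Literature.MathematicalPhysics.QuantumFieldTheory.Balaban1983to89.B6AxialGaugeDictionary

end
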